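import Mathlib
import Summits.ValiantsHypothesis.ValiantsHypothesis.Theorems.BarrierLeverPartitionMinorsHitByVPHiddenStatesFullJoinDoor

/-!
# Route BarrierLever — item `PartitionMinorsHitByVP` (stmt-ValiantsHypothesis-19717), line `hidden_states`:
# THE DOOR WITH A FREE EXPONENT — any polynomial number of states, and the one-sided arrow for `K ≤ h^e`

Helper file (`--supports stmt-ValiantsHypothesis-19717`; cell valiant-natproofs, rung V4, 𝒟-side door (c), line
`Cruxes/PartitionMinorsHitByVP/Lines/hidden_states.lean` v8; prover seat val-np-p3 gen 16). Definition-free. Closes NO item.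

THE POINT (memo val-np-p3 g16 «full join» §16–§17). The item asks for SOME exponent `b`; the one-cube door p672458 fixed `b = 8` and hence
`K ≤ h³` states. The universal flat design of §16 may need more states (its level-2 slack heuristically grows like `h²`, higher levels are
unexplored), so here is the door with a free exponent: a nonsingular one-cube full hidden sum with `K ≤ h^e` states (`h ≥ 3`) gives
`f ∈ SmallCircuits ℂ (h+h) (e+5)` (`partitionMinor_hit_of_oneCube_pow`; the size bound of `partitionMinor_hit_of_fullJoin` is
`≤ 33·(2h)^{e+3} ≤ (2h)^{e+5}`), and the ONE-SIDED ARROW with a free exponent, hypothesis inlined (no new definition):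
`partitionMinorsHitByVP_of_universalDesign_pow` — if for some `e`, eventually in `h`, every `r ≤ 2^h` has ONE threshold design with `K ≤ h^e`
states good for every injective row family, then `PartitionMinorsHitByVP` (with `b = e + 5`).

WHAT THIS IS NOT: no design is certified here; item 19717 stays OPEN; nothing on crux 14610 or VP ≠ VNP.
-/

set_option linter.dupNamespace false

namespace Summit.ValiantsHypothesis.ValiantsHypothesis.Theorems.BarrierLever.HiddenStates

open Finset Matrix
open Literature.Barriers.ValiantsHypothesis Literature.Computability.AlgebraicComplexity

noncomputable section

namespace FullJoin

variable {h K r : ℕ}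

/-- Arithmetic of the free-exponent door: the size bound of `partitionMinor_hit_of_fullJoin` with one cube and `K ≤ h^e` states is at
most `(h+h)^(e+5)` once `h ≥ 3`. -/
theorem oneCube_size_le_pow (e : ℕ) (hh : 3 ≤ h) (hK : K ≤ h ^ e) :
    (h + h + 2) ^ 2 * (1 * (3 * (h + h) + (K * (3 * (h + h) + 2) + K) + 1 + 2) + 1) + (h + h + 1) ≤ (h + h) ^ (e + 5) := by
  set n := h + h with hn
  have hn6 : 6 ≤ n := by omega
  have hKn : K ≤ n ^ e := hK.trans (Nat.pow_le_pow_left (by omega) e)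
  have hne1 : n ≤ n ^ (e + 1) := by
    calc n = n ^ 1 := (pow_one n).symm
      _ ≤ n ^ (e + 1) := Nat.pow_le_pow_right (by omega) (by omega)
  have h1 : (n + 2) ^ 2 ≤ 4 * n ^ 2 := by nlinarith
  have h2 : 1 * (3 * n + (K * (3 * n + 2) + K) + 1 + 2) + 1 ≤ 8 * n ^ (e + 1) := by
    have hK3 : K * (3 * n + 2) + K = K * (3 * n + 3) := by ring
    rw [hK3]
    have : K * (3 * n + 3) ≤ n ^ e * (4 * n) := Nat.mul_le_mul hKn (by omega)
    have : n ^ e * (4 * n) = 4 * n ^ (e + 1) := by ring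
    have : (4 : ℕ) ≤ n ^ (e + 1) := le_trans (by omega) hne1
    nlinarith
  have h3 : n + 1 ≤ n ^ (e + 3) := by
    calc n + 1 ≤ n * n := by nlinarith
      _ = n ^ 2 := by ring
      _ ≤ n ^ (e + 3) := Nat.pow_le_pow_right (by omega) (by omega)
  calc (n + 2) ^ 2 * (1 * (3 * n + (K * (3 * n + 2) + K) + 1 + 2) + 1) + (n + 1)
      ≤ 4 * n ^ 2 * (8 * n ^ (e + 1)) + n ^ (e + 3) := by gcongr
    _ = 33 * n ^ (e + 3) := by ring
    _ ≤ n ^ 2 * n ^ (e + 3) := by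
        apply Nat.mul_le_mul_right
        nlinarith
    _ = n ^ (e + 5) := by ring

/-- **The one-cube door with a free exponent.** A nonsingular one-cube full hidden sum with `K ≤ h^e` states (`h ≥ 3`) yields a polynomial
of `SmallCircuits ℂ (h + h) (e + 5)` whose partition matrix on `(u, w)` is nonsingular. -/
theorem partitionMinor_hit_of_oneCube_pow (e : ℕ) (hh : 3 ≤ h) (hK : K ≤ h ^ e) (u w : Fin r → Finset (Fin h))
    (H : ∃ (tx ty : Option (Fin K) → Fin h → ℂ) (lam : Fin K → ℂ),
      (Matrix.of fun i j : Fin r => ∑ J : Finset (Fin K), (∏ q ∈ J, lam q) *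
        ((∏ a ∈ u i, (tx none a + ∑ q ∈ J, tx (some q) a)) * ∏ c ∈ w j, (ty none c + ∑ q ∈ J, ty (some q) c))).det ≠ 0) :
    ∃ f ∈ SmallCircuits ℂ (h + h) (e + 5),
      (Matrix.of fun i j : Fin r => MvPolynomial.coeff
        (∑ a ∈ u i, Finsupp.single (Fin.castAdd h a) 1 +
          ∑ c ∈ w j, Finsupp.single (Fin.natAdd h c) 1) f).det ≠ 0 := by
  obtain ⟨tx, ty, lam, hdet⟩ := H
  have hmat : (Matrix.of fun i j : Fin r => ∑ p : Fin 1, ∑ J : Finset (Fin K),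
      (fun _ : Fin 1 => (1 : ℂ)) p * (∏ k ∈ J, (fun _ : Fin 1 => lam) p k) *
      ((∏ a ∈ u i, ((fun _ : Fin 1 => tx) p none a + ∑ q ∈ J, (fun _ : Fin 1 => tx) p (some q) a)) *
        ∏ c ∈ w j, ((fun _ : Fin 1 => ty) p none c + ∑ q ∈ J, (fun _ : Fin 1 => ty) p (some q) c))) =
      Matrix.of fun i j : Fin r => ∑ J : Finset (Fin K), (∏ k ∈ J, lam k) *
        ((∏ a ∈ u i, (tx none a + ∑ q ∈ J, tx (some q) a)) *
          ∏ c ∈ w j, (ty none c + ∑ q ∈ J, ty (some q) c)) := by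
    refine Matrix.ext fun i j => ?_
    simp only [Matrix.of_apply, Fin.sum_univ_one, one_mul]
  have hdet' := hdet
  rw [← hmat] at hdet'
  obtain ⟨f, hdeg, hsize, hf⟩ := partitionMinor_hit_of_fullJoin h 1 K r u w (fun _ => tx) (fun _ => ty) (fun _ => 1)
    (fun _ => lam) hdet'
  exact ⟨f, ⟨hdeg, hsize.trans (oneCube_size_le_pow e hh hK)⟩, hf⟩

/-- An injective family of subsets of `Fin h` indexed by `Fin r` forces `r ≤ 2^h`. -/
theorem le_two_pow_of_injective' (u : Fin r → Finset (Fin h)) (hu : Function.Injective u) : r ≤ 2 ^ h := by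
  have := Fintype.card_le_of_injective u hu
  simpa [Fintype.card_fin, Fintype.card_finset] using this

/-- **The one-sided arrow with a free exponent** (hypothesis inlined): ONE threshold design per `(h, r)` with `K ≤ h^e` states that is
good for every injective row family implies `PartitionMinorsHitByVP` with `b = e + 5`. -/
theorem partitionMinorsHitByVP_of_universalDesign_pow (e : ℕ)
    (H : ∃ h₁ : ℕ, ∀ h : ℕ, h₁ ≤ h → ∀ r : ℕ, r ≤ 2 ^ h →
      ∃ (K : ℕ) (J : Fin r → Finset (Fin K)) (wt : Fin K → ℕ), K ≤ h ^ e ∧ Function.Injective J ∧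
        (∀ J' : Finset (Fin K), J' ∉ Set.range J → ∀ k : Fin r, ∑ q ∈ J k, wt q < ∑ q ∈ J', wt q) ∧
        ∀ u : Fin r → Finset (Fin h), Function.Injective u →
          ∃ tx : Option (Fin K) → Fin h → ℂ,
            (Matrix.of fun i k : Fin r => ∏ a ∈ u i, (tx none a + ∑ q ∈ J k, tx (some q) a)).det ≠ 0) :
    Summit.ValiantsHypothesis.ValiantsHypothesis.Theses.BarrierLever.PartitionMinorsHitByVP := by
  classical
  obtain ⟨h₁, H⟩ := H
  refine ⟨e + 5, max h₁ 3, fun h hh r u w hu hw => ?_⟩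
  have hh₁ : h₁ ≤ h := le_trans (le_max_left _ _) hh
  have hh3 : 3 ≤ h := le_trans (le_max_right _ _) hh
  obtain ⟨K, J, wt, hK, hJ, hthr, hgood⟩ := H h hh₁ r (le_two_pow_of_injective' u hu)
  obtain ⟨tx, hx⟩ := hgood u hu
  obtain ⟨ty, hy⟩ := hgood w hw
  have hthr' : ∀ x : Fin 1 × Finset (Fin K), x ∉ Set.range (fun k : Fin r => ((0 : Fin 1), J k)) →
      ∀ i : Fin r, (fun _ : Fin 1 => (0 : ℕ)) ((fun k : Fin r => ((0 : Fin 1), J k)) i).1 +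
          ∑ q ∈ ((fun k : Fin r => ((0 : Fin 1), J k)) i).2, (fun (_ : Fin 1) (q : Fin K) => wt q) ((fun k : Fin r => ((0 : Fin 1), J k)) i).1 q <
        (fun _ : Fin 1 => (0 : ℕ)) x.1 + ∑ q ∈ x.2, (fun (_ : Fin 1) (q : Fin K) => wt q) x.1 q := by
    intro x hx' i
    have hx2 : x.2 ∉ Set.range J := by
      rintro ⟨k, hk⟩
      apply hx'
      refine ⟨k, ?_⟩
      ext
      · simp [Subsingleton.elim x.1 0]
      · simp [hk]
    simpa using hthr x.2 hx2 i
  have he : Function.Injective (fun k : Fin r => ((0 : Fin 1), J k)) := fun k k' hkk' => hJ (by simpa using hkk')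
  obtain ⟨t₀, hdet⟩ := fullJoin_det_ne_zero_of_threshold h 1 K r u w (fun k => ((0 : Fin 1), J k)) he (fun _ => 0)
    (fun _ q => wt q) hthr' (fun _ => tx) (fun _ => ty) (by simpa using hx) (by simpa using hy)
  refine partitionMinor_hit_of_oneCube_pow e hh3 hK u w ⟨tx, ty, fun q => t₀ ^ wt q, ?_⟩
  simpa using hdet

end FullJoin

end

end Summit.ValiantsHypothesis.ValiantsHypothesis.Theorems.BarrierLever.HiddenStates
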